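import Mathlib
import Summits.Ventures.PercRepro2.Defs
import Summits.Ventures.PercRepro2.Graph
import Summits.Ventures.PercRepro2.OneColourSwitch
import Summits.Ventures.PercRepro2.RegionHubSign
import Summits.Ventures.PercRepro2.SideSwitch
import Summits.Ventures.PercRepro2.M9LoopTransfer
import Summits.Ventures.PercRepro2.M9NoPocketDefs
import Summits.Ventures.PercRepro2.M9EdgeTransfer
import Summits.Ventures.PercRepro2.M9GammaSum

/-!
# An `r–s` edge is free: looping it halves the sign sums (blind cell PercRepro2, p3 g24,
2026-08-28; `proofs/P3-CONJG.md` §7(d))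

For an edge `e` with ends `{r, s}`, the two-colour worlds of `{r, s}`, the separation `Sep`, the
predicate `DOne` and `σ_pq` do not see the colour of `e` nor whether `e` is present
(`K2_loop`, `M2_loop`, `sep2_loop`, `DOne_loop`, `sigma_pq_loop`), while the two colours of `e`
sum to `σ_rs` of the graph with `e` looped (`sigma_rs_add_flip`).  Hence
`2 · dSignSum = dSignSum (e looped)` (`dSignSum_loop_rs`) and
`2 · m9SignSum = m9SignSum (e looped)` (`m9SignSum_loop_rs`): every statement of the family may
assume that there is no edge between `r` and `s`.  Own work; std axioms.
-/

namespace Summit.Ventures.PercRepro2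

namespace NoPocket

open Finset Classical RegionHub OneColourSwitch SideSwitch

variable {V : Type*} {E : Type*}

section Loop

variable [DecidableEq E] {ends : E → Sym2 V} {r s : V} {e : E}

/-- The graph with `e` looped at `r`. -/
noncomputable def loopRS (ends : E → Sym2 V) (r : V) (e : E) : E → Sym2 V :=
  Function.update ends e s(r, r)

/-- The looped edge is a loop. -/
lemma loopRS_isDiag : (loopRS ends r e e).IsDiag := by
  simp [loopRS, Sym2.mk_isDiag_iff]

/-- Restoring `e` in the looped graph gives the graph back. -/
lemma update_loopRS (he : ends e = s(r, s)) : Function.update (loopRS ends r e) e s(r, s) = ends := by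
  simp only [loopRS, Function.update_idem]
  rw [← he]
  exact Function.update_eq_self _ _

/-- With `e` closed, the connections are those of the looped graph. -/
lemma conn_iff_loopRS_of_closed {ω : Config E} (h : ω e = false) {u v : V} :
    Conn ends ω u v ↔ Conn (loopRS ends r e) ω u v := by
  constructor
  · refine conn_of_open_agree (fun e' he' _ => ⟨?_, he'⟩)
    have hne : e' ≠ e := by rintro rfl; rw [h] at he'; exact Bool.false_ne_true he'
    simp [loopRS, Function.update_of_ne hne]
  · refine conn_of_open_agree (fun e' he' _ => ⟨?_, he'⟩)
    have hne : e' ≠ e := by rintro rfl; rw [h] at he'; exact Bool.false_ne_true he'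
    simp [loopRS, Function.update_of_ne hne]

/-- With `e` open, a connection of `ends` is a connection of the looped graph or goes through
the edge `{r, s}`. -/
lemma conn_iff_loopRS_of_open (he : ends e = s(r, s)) {ω : Config E} (h : ω e = true) {u v : V} :
    Conn ends ω u v ↔ Conn (loopRS ends r e) ω u v ∨
      (Conn (loopRS ends r e) ω u r ∧ Conn (loopRS ends r e) ω s v) ∨
      (Conn (loopRS ends r e) ω u s ∧ Conn (loopRS ends r e) ω r v) := by
  have key := conn_update_edge_iff (ends := loopRS ends r e) (e₀ := e) loopRS_isDiag
    (x := r) (y := s) (ω := ω) h (u := u) (v := v)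
  rwa [update_loopRS he] at key

/-- Connections of the looped graph are connections of `ends`. -/
lemma conn_of_conn_loopRS {ω : Config E} {u v : V} (hc : Conn (loopRS ends r e) ω u v) :
    Conn ends ω u v := by
  refine conn_of_open_agree (fun e' he' hnd => ⟨?_, he'⟩) hc
  have hne : e' ≠ e := by rintro rfl; exact hnd loopRS_isDiag
  simp [loopRS, Function.update_of_ne hne]

/-- Recolouring `e` does not change the connections of the looped graph. -/
lemma conn_loopRS_update {ω : Config E} {b : Bool} {u v : V} :
    Conn (loopRS ends r e) (Function.update ω e b) u v ↔ Conn (loopRS ends r e) ω u v :=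
  M9Reduce.conn_update_loop_iff loopRS_isDiag

/-- **The `Y`-world of `{r, s}` does not see the edge `e`.** -/
lemma K2_loopRS (he : ends e = s(r, s)) (ω : Config E) :
    K2 ends r s ω = K2 (loopRS ends r e) r s ω := by
  ext x
  rw [mem_K2_iff, mem_K2_iff]
  cases h : ω e
  · rw [conn_iff_loopRS_of_closed (ends := ends) (r := r) (u := r) (v := x) h,
      conn_iff_loopRS_of_closed (ends := ends) (r := r) (u := s) (v := x) h]
  · rw [conn_iff_loopRS_of_open (ends := ends) he (u := r) (v := x) h,
      conn_iff_loopRS_of_open (ends := ends) he (u := s) (v := x) h]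
    constructor
    · rintro ((h1 | ⟨_, h1⟩ | ⟨_, h1⟩) | (h1 | ⟨_, h1⟩ | ⟨_, h1⟩))
      · exact Or.inl h1
      · exact Or.inr h1
      · exact Or.inl h1
      · exact Or.inr h1
      · exact Or.inr h1
      · exact Or.inl h1
    · rintro (h1 | h1)
      · exact Or.inl (Or.inl h1)
      · exact Or.inr (Or.inl h1)

/-- **The `W`-world of `{r, s}` does not see the edge `e`.** -/
lemma M2_loopRS (he : ends e = s(r, s)) (ω : Config E) :
    M2 ends r s ω = M2 (loopRS ends r e) r s ω :=
  K2_loopRS he (OneColourSwitch.compl ω)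

/-- A vertex joined to `r` or `s` in the looped graph is joined to it in `ends`; conversely a
vertex not joined to `r` nor `s` in `ends` is joined to neither in the looped graph. -/
lemma not_conn_loopRS_of_not_conn {ω : Config E} {x : V}
    (h : ¬ Conn ends ω x r ∧ ¬ Conn ends ω x s) :
    ¬ Conn (loopRS ends r e) ω x r ∧ ¬ Conn (loopRS ends r e) ω x s :=
  ⟨fun hc => h.1 (conn_of_conn_loopRS hc), fun hc => h.2 (conn_of_conn_loopRS hc)⟩

/-- **`Sep` does not see the edge `e`.** -/
lemma sep2_loopRS (he : ends e = s(r, s)) {p q : V} (ω : Config E) :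
    sep2 ends p q r s ω ↔ sep2 (loopRS ends r e) p q r s ω := by
  have key : ∀ ω' : Config E, ∀ x, (¬ Conn ends ω' x r ∧ ¬ Conn ends ω' x s) ↔
      (¬ Conn (loopRS ends r e) ω' x r ∧ ¬ Conn (loopRS ends r e) ω' x s) := by
    intro ω' x
    have h1 : x ∈ K2 ends r s ω' ↔ x ∈ K2 (loopRS ends r e) r s ω' := by rw [K2_loopRS he]
    rw [mem_K2_iff, mem_K2_iff] at h1
    constructor
    · intro h
      exact not_conn_loopRS_of_not_conn h
    · rintro ⟨h1', h2'⟩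
      have : ¬ (Conn ends ω' r x ∨ Conn ends ω' s x) := fun h => by
        rcases h1.1 h with h | h
        · exact h1' (conn_symm h)
        · exact h2' (conn_symm h)
      exact ⟨fun h => this (Or.inl (conn_symm h)), fun h => this (Or.inr (conn_symm h))⟩
  simp only [sep2, sepY]
  have e1 := key ω p; have e2 := key ω q
  have e3 := key (OneColourSwitch.compl ω) p; have e4 := key (OneColourSwitch.compl ω) q
  constructor
  · rintro ⟨⟨a1, a2, a3, a4⟩, ⟨b1, b2, b3, b4⟩⟩
    exact ⟨⟨(e1.1 ⟨a1, a2⟩).1, (e1.1 ⟨a1, a2⟩).2, (e2.1 ⟨a3, a4⟩).1, (e2.1 ⟨a3, a4⟩).2⟩,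
      ⟨(e3.1 ⟨b1, b2⟩).1, (e3.1 ⟨b1, b2⟩).2, (e4.1 ⟨b3, b4⟩).1, (e4.1 ⟨b3, b4⟩).2⟩⟩
  · rintro ⟨⟨a1, a2, a3, a4⟩, ⟨b1, b2, b3, b4⟩⟩
    exact ⟨⟨(e1.2 ⟨a1, a2⟩).1, (e1.2 ⟨a1, a2⟩).2, (e2.2 ⟨a3, a4⟩).1, (e2.2 ⟨a3, a4⟩).2⟩,
      ⟨(e3.2 ⟨b1, b2⟩).1, (e3.2 ⟨b1, b2⟩).2, (e4.2 ⟨b3, b4⟩).1, (e4.2 ⟨b3, b4⟩).2⟩⟩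

/-- **`DOne` does not see the edge `e`.** -/
lemma DOne_loopRS (he : ends e = s(r, s)) {d : V} (ω : Config E) :
    DOne ends r s d ω ↔ DOne (loopRS ends r e) r s d ω := by
  simp only [DOne, K2_loopRS he, M2_loopRS he]

/-- **`σ_pq` of a `Sep`-colouring does not see the edge `e`.** -/
lemma sigma_pq_loopRS [Fintype E] (he : ends e = s(r, s)) {p q : V} {ω : Config E}
    (hsep : sep2 ends p q r s ω) : sigma ends ω p q = sigma (loopRS ends r e) ω p q := by
  have key : ∀ ω' : Config E, (¬ Conn ends ω' p r ∧ ¬ Conn ends ω' p s) →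
      (Conn ends ω' p q ↔ Conn (loopRS ends r e) ω' p q) := by
    intro ω' hp
    cases h : ω' e
    · exact conn_iff_loopRS_of_closed (r := r) h
    · rw [conn_iff_loopRS_of_open he h]
      constructor
      · rintro (h1 | ⟨h1, _⟩ | ⟨h1, _⟩)
        · exact h1
        · exact absurd (conn_of_conn_loopRS h1) hp.1
        · exact absurd (conn_of_conn_loopRS h1) hp.2
      · exact fun h1 => Or.inl h1
  obtain ⟨⟨a1, a2, _, _⟩, ⟨b1, b2, _, _⟩⟩ := hsep
  simp only [sigma, key ω ⟨a1, a2⟩, key (OneColourSwitch.compl ω) ⟨b1, b2⟩]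

/-- `σ_rs` when `e` is open: `1 − 1[r ~_W s in the looped graph]`. -/
lemma sigma_rs_of_open [Fintype E] (he : ends e = s(r, s)) {ω : Config E} (h : ω e = true) :
    sigma ends ω r s =
      1 - (if Conn (loopRS ends r e) (OneColourSwitch.compl ω) r s then 1 else 0) := by
  have hc : OneColourSwitch.compl ω e = false := by simp [OneColourSwitch.compl, h]
  have e1 := conn_iff_loopRS_of_closed (ends := ends) (r := r) (ω := OneColourSwitch.compl ω)
    (u := r) (v := s) hc
  unfold sigma
  rw [if_pos (conn_of_openAdj ⟨e, h, he⟩)]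
  simp only [e1]

/-- `σ_rs` when `e` is closed: `1[r ~_Y s in the looped graph] − 1`. -/
lemma sigma_rs_of_closed [Fintype E] (he : ends e = s(r, s)) {ω : Config E} (h : ω e = false) :
    sigma ends ω r s = (if Conn (loopRS ends r e) ω r s then 1 else 0) - 1 := by
  have hc : OneColourSwitch.compl ω e = true := by simp [OneColourSwitch.compl, h]
  have e1 := conn_iff_loopRS_of_closed (ends := ends) (r := r) (ω := ω) (u := r) (v := s) h
  unfold sigma
  rw [if_pos (conn_of_openAdj ⟨e, hc, he⟩)]
  simp only [e1]

/-- **The two colours of `e` sum to `σ_rs` of the looped graph.** -/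
lemma sigma_rs_add_flip [Fintype E] (he : ends e = s(r, s)) (ω : Config E) :
    sigma ends ω r s + sigma ends (Function.update ω e (!ω e)) r s =
      sigma (loopRS ends r e) ω r s := by
  cases h : ω e
  · -- `e` closed; the flip opens it
    have h' : Function.update ω e (!false) e = true := by simp
    rw [sigma_rs_of_closed he h, sigma_rs_of_open he h', M9Reduce.compl_update]
    simp only [Bool.not_not, conn_loopRS_update (ends := ends) (r := r), sigma]
    ring
  · -- `e` open; the flip closes it
    have h' : Function.update ω e (!true) e = false := by simp
    rw [sigma_rs_of_open he h, sigma_rs_of_closed he h']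
    simp only [conn_loopRS_update (ends := ends) (r := r), sigma]
    ring

end Loop

section Sums

variable [Fintype E] [DecidableEq E] {ends : E → Sym2 V} {p q r s d : V} {e : E}

/-- **Looping an `r–s` edge halves the single-`d` sum**: `2 · dSignSum = dSignSum (e looped)`. -/
theorem dSignSum_loop_rs (he : ends e = s(r, s)) :
    2 * dSignSum ends p q r s d = dSignSum (loopRS ends r e) p q r s d := by
  unfold dSignSum
  set F : Config E → ℤ := fun ω => if sep2 ends p q r s ω ∧ DOne ends r s d ω then
    sigma ends ω p q * sigma ends ω r s else 0 with hF
  have hre : ∑ ω, F (flipEdge e ω) = ∑ ω, F ω := sum_flipEdge e F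
  have h2 : 2 * ∑ ω, F ω = ∑ ω, (F ω + F (flipEdge e ω)) := by
    rw [Finset.sum_add_distrib, hre]; ring
  rw [h2]
  refine Finset.sum_congr rfl fun ω _ => ?_
  simp only [hF, flipEdge_apply]
  -- `Sep`, `DOne` and `σ_pq` are the same at `ω` and at the flip; both equal the looped values
  have hK : ∀ ω₁ ω₂ : Config E, (∀ e', e' ≠ e → ω₁ e' = ω₂ e') →
      K2 (loopRS ends r e) r s ω₁ = K2 (loopRS ends r e) r s ω₂ := by
    intro ω₁ ω₂ h12
    have : ω₂ = Function.update ω₁ e (ω₂ e) := by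
      funext e'
      by_cases hh : e' = e
      · rw [hh, Function.update_self]
      · rw [Function.update_of_ne hh, h12 e' hh]
    rw [this]
    ext x
    rw [mem_K2_iff, mem_K2_iff]
    simp only [conn_loopRS_update]
  have hagree : ∀ e', e' ≠ e → ω e' = Function.update ω e (!ω e) e' :=
    fun e' h => by rw [Function.update_of_ne h]
  have hagreeC : ∀ e', e' ≠ e → OneColourSwitch.compl ω e' =
      OneColourSwitch.compl (Function.update ω e (!ω e)) e' :=
    fun e' h => by simp [OneColourSwitch.compl, Function.update_of_ne h]
  have hsep : sep2 ends p q r s ω ↔ sep2 ends p q r s (Function.update ω e (!ω e)) := by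
    rw [sep2_loopRS he, sep2_loopRS he]
    simp only [sep2, sepY, M9Reduce.compl_update, conn_loopRS_update]
  have hD : DOne ends r s d ω ↔ DOne ends r s d (Function.update ω e (!ω e)) := by
    rw [DOne_loopRS he, DOne_loopRS he]
    simp only [DOne]
    rw [hK ω _ hagree, show M2 (loopRS ends r e) r s ω =
      M2 (loopRS ends r e) r s (Function.update ω e (!ω e)) from hK _ _ hagreeC]
  have hpq : sigma (loopRS ends r e) (Function.update ω e (!ω e)) p q =
      sigma (loopRS ends r e) ω p q := by
    unfold sigma
    simp only [M9Reduce.compl_update, conn_loopRS_update]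
  by_cases hL : sep2 ends p q r s ω ∧ DOne ends r s d ω
  · have hL' : sep2 ends p q r s (Function.update ω e (!ω e)) ∧
        DOne ends r s d (Function.update ω e (!ω e)) := ⟨hsep.1 hL.1, hD.1 hL.2⟩
    have hLl : sep2 (loopRS ends r e) p q r s ω ∧ DOne (loopRS ends r e) r s d ω :=
      ⟨(sep2_loopRS he ω).1 hL.1, (DOne_loopRS he ω).1 hL.2⟩
    rw [if_pos hL, if_pos hL', if_pos hLl, sigma_pq_loopRS he hL.1, sigma_pq_loopRS he hL'.1,
      hpq, ← mul_add, sigma_rs_add_flip he]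
  · have hL' : ¬ (sep2 ends p q r s (Function.update ω e (!ω e)) ∧
        DOne ends r s d (Function.update ω e (!ω e))) := fun h => hL ⟨hsep.2 h.1, hD.2 h.2⟩
    have hLl : ¬ (sep2 (loopRS ends r e) p q r s ω ∧ DOne (loopRS ends r e) r s d ω) :=
      fun h => hL ⟨(sep2_loopRS he ω).2 h.1, (DOne_loopRS he ω).2 h.2⟩
    rw [if_neg hL, if_neg hL', if_neg hLl, add_zero]

/-- **Looping an `r–s` edge halves the `m9` sign sum**: `2 · m9SignSum = m9SignSum (e looped)`. -/
theorem m9SignSum_loop_rs (he : ends e = s(r, s)) :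
    2 * m9SignSum ends p q r s = m9SignSum (loopRS ends r e) p q r s := by
  unfold m9SignSum
  set F : Config E → ℤ := fun ω => if sep2 ends p q r s ω then
    sigma ends ω p q * sigma ends ω r s else 0 with hF
  have hre : ∑ ω, F (flipEdge e ω) = ∑ ω, F ω := sum_flipEdge e F
  have h2 : 2 * ∑ ω, F ω = ∑ ω, (F ω + F (flipEdge e ω)) := by
    rw [Finset.sum_add_distrib, hre]; ring
  rw [h2]
  refine Finset.sum_congr rfl fun ω _ => ?_
  simp only [hF, flipEdge_apply]
  have hsep : sep2 ends p q r s ω ↔ sep2 ends p q r s (Function.update ω e (!ω e)) := by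
    rw [sep2_loopRS he, sep2_loopRS he]
    simp only [sep2, sepY, M9Reduce.compl_update, conn_loopRS_update]
  have hpq : sigma (loopRS ends r e) (Function.update ω e (!ω e)) p q =
      sigma (loopRS ends r e) ω p q := by
    unfold sigma
    simp only [M9Reduce.compl_update, conn_loopRS_update]
  by_cases hL : sep2 ends p q r s ω
  · have hL' : sep2 ends p q r s (Function.update ω e (!ω e)) := hsep.1 hL
    have hLl : sep2 (loopRS ends r e) p q r s ω := (sep2_loopRS he ω).1 hL
    rw [if_pos hL, if_pos hL', if_pos hLl, sigma_pq_loopRS he hL, sigma_pq_loopRS he hL',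
      hpq, ← mul_add, sigma_rs_add_flip he]
  · have hL' : ¬ sep2 ends p q r s (Function.update ω e (!ω e)) := fun h => hL (hsep.2 h)
    have hLl : ¬ sep2 (loopRS ends r e) p q r s ω := fun h => hL ((sep2_loopRS he ω).2 h)
    rw [if_neg hL, if_neg hL', if_neg hLl, add_zero]

end Sums


end NoPocket

end Summit.Ventures.PercRepro2
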